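import Mathlib.AlgebraicGeometry.EllipticCurve.Affine.Point
import Mathlib.GroupTheory.OrderOfElement
import Mathlib.RingTheory.ClassGroup.Basic

/-!
# Divisors supported on torsion points of an elliptic curve have principal multiples

Classical fact (affine Weierstrass model over a field `F`): if `P₁, …, Pₙ` are torsion points of
`E(F)` and `n₁, …, nₙ ∈ ℤ`, then some positive multiple of the divisor `∑ nᵢ (Pᵢ)` (completed to
degree zero by a multiple of the point at infinity) is principal.  In the language Mathlib has —
the affine coordinate ring `F[W]` of a Weierstrass curve `W`, whose ideal class group receives the
injective group homomorphism `WeierstrassCurve.Affine.Point.toClass : W.Point →+ Additive (ClassGroup F[W])`,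
`(x, y) ↦ [⟨X − x, Y − y⟩]` (the Mathlib proof of the group law) — this reads: the class
`∑ nᵢ • toClass Pᵢ` has finite order, i.e. for the invertible fractional ideals
`𝔭ᵢ = ⟨X − xᵢ, Y − yᵢ⟩` some power `(∏ 𝔭ᵢ^{nᵢ})^N`, `N ≥ 1`, is principal; if `N • Pᵢ = 0` for
all `i` one may take that `N`.

Source: corollary of Abel's theorem for elliptic curves, Silverman, *The Arithmetic of Elliptic
Curves*, 2nd ed., Cor. III.3.5 (a divisor `∑ n_P (P)` is principal iff `∑ n_P = 0` and
`∑ [n_P] P = O`).  Use site in this tree: it is the classical input quoted verbatim in the proof of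
[IUTchI] Cor. 5.3 (iv), kurims manuscript p. 145 («since any divisor of degree zero on an elliptic
curve that is supported on the torsion points of the elliptic curve admits a positive multiple
which is principal») — Mochizuki, *Inter-universal Teichmüller theory I* (node `IUTchI:Cor5.3(iv)`;
the node itself is typed over the interface `PMBaseKit.FKit` in `Literature/IUT/HodgeTheaters/` and
is not touched here).

What is NOT here: divisors on the projective curve / function-field principal divisors as such
(Mathlib has no divisor group of a curve); the statement is given at the level Mathlib supports,
the ideal class group of the affine coordinate ring (≅ Pic⁰(E) for an elliptic curve).
-/

namespace Literature.NumberTheory.EllipticCurves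

open WeierstrassCurve WeierstrassCurve.Affine WeierstrassCurve.Affine.Point
open scoped nonZeroDivisors

universe u

variable {F : Type u} [Field F] [DecidableEq F] {W : WeierstrassCurve.Affine F}

/-- The ideal class `[⟨X − x, Y − y⟩] ∈ Cl(F[W])` of a torsion point `P = (x, y)` of a Weierstrass
curve has finite order (image of a torsion element under the group homomorphism `toClass`).
[cite: SilvermanAEC2009, Cor. III.3.5] -/
theorem isOfFinAddOrder_toClass {P : W.Point} (hP : IsOfFinAddOrder P) :
    IsOfFinAddOrder (toClass P) :=
  AddMonoidHom.isOfFinAddOrder toClass hP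

/-- **Divisors supported on torsion points have principal multiples** (class-group form): for
torsion points `Pᵢ` and integers `nᵢ`, the class `∑ᵢ nᵢ • [𝔭_{Pᵢ}]` in the ideal class group of the
affine coordinate ring has finite order.  (Silverman, AEC, Cor. III.3.5; the input of [IUTchI]
Cor. 5.3 (iv), proof p. 145.) [cite: SilvermanAEC2009, Cor. III.3.5] -/
theorem isOfFinAddOrder_sum_zsmul_toClass {ι : Type*} (s : Finset ι) (n : ι → ℤ) (P : ι → W.Point)
    (hP : ∀ i ∈ s, IsOfFinAddOrder (P i)) :
    IsOfFinAddOrder (∑ i ∈ s, n i • toClass (P i)) := by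
  classical
  induction s using Finset.induction_on with
  | empty => simp [IsOfFinAddOrder.zero]
  | insert a s ha ih =>
    rw [Finset.sum_insert ha]
    exact ((isOfFinAddOrder_toClass (hP a (Finset.mem_insert_self a s))).zsmul).add
      (ih fun i hi => hP i (Finset.mem_insert_of_mem hi))

/-- Uniform-exponent form: if `N • Pᵢ = 0` for every `i`, then `N • ∑ᵢ nᵢ • [𝔭_{Pᵢ}] = 0` in the
ideal class group of the affine coordinate ring. [cite: SilvermanAEC2009, Cor. III.3.5] -/
theorem nsmul_sum_zsmul_toClass_eq_zero {ι : Type*} (s : Finset ι) (n : ι → ℤ) (P : ι → W.Point)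
    (N : ℕ) (hP : ∀ i ∈ s, N • P i = 0) :
    N • (∑ i ∈ s, n i • toClass (P i)) = 0 := by
  rw [Finset.smul_sum]
  refine Finset.sum_eq_zero fun i hi => ?_
  rw [smul_comm, ← map_nsmul, hP i hi, _root_.map_zero, smul_zero]

/-- **Divisors supported on torsion points have principal multiples** (fractional-ideal form, the
statement as used in [IUTchI] Cor. 5.3 (iv), proof p. 145): let `(xᵢ, yᵢ)` be nonsingular
`F`-points of the Weierstrass curve `W` which are torsion in `E(F)`, `𝔭ᵢ = ⟨X − xᵢ, Y − yᵢ⟩` the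
corresponding invertible fractional ideals of the affine coordinate ring, and `nᵢ ∈ ℤ`.  Then there
is `N ≥ 1` such that `(∏ᵢ 𝔭ᵢ^{nᵢ})^N` is principal. [cite: SilvermanAEC2009, Cor. III.3.5] -/
theorem exists_pow_prod_XYIdeal'_isPrincipal {ι : Type*} (s : Finset ι) (n : ι → ℤ) (x y : ι → F)
    (h : ∀ i, W.Nonsingular (x i) (y i))
    (hP : ∀ i ∈ s, IsOfFinAddOrder (Point.some (x i) (y i) (h i))) :
    ∃ N : ℕ, 0 < N ∧
      ((((∏ i ∈ s, CoordinateRing.XYIdeal' (W := W) (h i) ^ n i) ^ N :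
          (FractionalIdeal W.CoordinateRing⁰ W.FunctionField)ˣ) :
          FractionalIdeal W.CoordinateRing⁰ W.FunctionField) :
        Submodule W.CoordinateRing W.FunctionField).IsPrincipal := by
  classical
  have hfin := isOfFinAddOrder_sum_zsmul_toClass s n (fun i => Point.some (x i) (y i) (h i)) hP
  obtain ⟨N, hN, hN0⟩ := hfin.exists_nsmul_eq_zero
  refine ⟨N, hN, ?_⟩
  rw [← ClassGroup.mk_eq_one_iff, map_pow, map_prod]
  have : ∀ i ∈ s, ClassGroup.mk W.FunctionField (CoordinateRing.XYIdeal' (W := W) (h i) ^ n i) =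
      Additive.toMul (n i • toClass (Point.some (x i) (y i) (h i))) := fun i _ => by
    rw [map_zpow, toClass_some]
    rfl
  rw [Finset.prod_congr rfl this]
  change Additive.toMul (N • ∑ i ∈ s, n i • toClass (Point.some (x i) (y i) (h i))) = 1
  rw [hN0]
  rfl

/-- Uniform-exponent fractional-ideal form: if `N • (xᵢ, yᵢ) = 0` in `E(F)` for every `i`
(`N ≥ 1`), then `(∏ᵢ 𝔭ᵢ^{nᵢ})^N` is principal. [cite: SilvermanAEC2009, Cor. III.3.5] -/
theorem pow_prod_XYIdeal'_isPrincipal_of_nsmul_eq_zero {ι : Type*} (s : Finset ι) (n : ι → ℤ)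
    (x y : ι → F) (h : ∀ i, W.Nonsingular (x i) (y i)) (N : ℕ)
    (hP : ∀ i ∈ s, N • Point.some (x i) (y i) (h i) = 0) :
    ((((∏ i ∈ s, CoordinateRing.XYIdeal' (W := W) (h i) ^ n i) ^ N :
          (FractionalIdeal W.CoordinateRing⁰ W.FunctionField)ˣ) :
          FractionalIdeal W.CoordinateRing⁰ W.FunctionField) :
        Submodule W.CoordinateRing W.FunctionField).IsPrincipal := by
  classical
  rw [← ClassGroup.mk_eq_one_iff, map_pow, map_prod]
  have : ∀ i ∈ s, ClassGroup.mk W.FunctionField (CoordinateRing.XYIdeal' (W := W) (h i) ^ n i) =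
      Additive.toMul (n i • toClass (Point.some (x i) (y i) (h i))) := fun i _ => by
    rw [map_zpow, toClass_some]
    rfl
  rw [Finset.prod_congr rfl this]
  change Additive.toMul (N • ∑ i ∈ s, n i • toClass (Point.some (x i) (y i) (h i))) = 1
  rw [nsmul_sum_zsmul_toClass_eq_zero s n _ N hP]
  rfl

end Literature.NumberTheory.EllipticCurves
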